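import Literature.NumberTheory.EllipticCurves.HasseWeilGoodReductionFrobeniusProofs
import Literature.NumberTheory.EllipticCurves.SpectralValuationUnramified
import Literature.NumberTheory.EllipticCurves.KodairaNeronUnramifiedInertiaProofs
import Mathlib.RingTheory.RootsOfUnity.AlgebraicallyClosed
import Mathlib.FieldTheory.Galois.Infinite
import HarnessLib

/-!
# The unramified layers `K_v(ζ_{qⁿ-1}) ⊆ K̄_v`: Frobenius, inertia, descent, discreteness,
# completeness

`Proofs` file (theorems only, no definitions, no named facts) in topic
`NumberTheory/EllipticCurves`; a bottom-up step of the discharge of the named fact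
`Literature.NumberTheory.EllipticCurves.Milne2006_unramifiedClass_eq_zero` (`PeriodIndexSupport`;
Milne, *Arithmetic Duality Theorems*, Prop. I.3.8), which is proved over the finite unramified
layers of `K̄_v/K_v`.  Classically (Serre, *Local Fields*, IV §4; Neukirch, *ANT*, II (7.12)–(7.13))
the unramified extension of degree `n` of the local field `K_v` (residue field `k_v`, `q = #k_v`)
is `K_n = K_v(ζ)` for a primitive `(qⁿ - 1)`-th root of unity `ζ`, with Frobenius `F ζ = ζ^q`
and residue field `𝔽_{qⁿ}`.  This file establishes what the discharge needs about these layers,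
inside `L = K̄_v` with its spectral valuation `w = |·|_v` (`SelmerFiniteProofs`), for the local
objects of the tree (`Γ = Γ_{K_v}`, the prime `𝔐` of the local absolute integers, its inertia
group `I_𝔐`, an arithmetic Frobenius `F` at `𝔐`):

* §1 roots of unity of order prime to `p` under a valuation: `|ζ| = 1`; two such roots congruent
  modulo `𝔪` are equal (`eq_of_pow_eq_one_of_val_sub_lt_one`: `|η - 1| < 1`, `η^d = 1`, `|d| = 1`
  force `η = 1`, by `η^d - 1 = (η - 1)(1 + η + ⋯ + η^{d-1})` and `|1 + η + ⋯| = |d| = 1`);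
* §2 in `K̄_v`: `|q|_v < 1`, `|qⁿ - 1|_v = 1`, existence of primitive `(qⁿ - 1)`-th roots `ζ`
  (`L` is algebraically closed of characteristic `0`), **inertia fixes `ζ`**
  (`smul_eq_self_of_mem_inertia_of_pow_eq_one`), **`F ζ = ζ^q`**
  (`frobenius_smul_eq_pow_of_pow_eq_one`), `Fʲ ζ = ζ^{qʲ}`, and `Fʲ ζ = ζ ↔ n ∣ j`;
* §3 the layer `K_v(ζ) = IntermediateField.adjoin K_v {ζ}` (no definition is introduced): finite
  over `K_v`, stable under `F` with `Fⁿ = 1` on it, fixed pointwise by `I_𝔐` (so inside the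
  maximal unramified extension), fixed pointwise by `σ` iff `σ ζ = ζ`, **Galois descent**
  (`mem_adjoin_of_forall_smul_eq`: an element fixed by every `σ` with `σ ζ = ζ` lies in
  `K_v(ζ)`; infinite Galois theory, Mathlib `InfiniteGalois.fixedField_fixingSubgroup`),
  **discreteness** (`spectralValuation_le_uniformizer_of_mem_adjoin`: `|x|_v < 1 ⇒ |x|_v ≤ |ϖ|_v`
  on `K_v(ζ)`, from the tree's `spectralValuation_le_of_forall_inertia`, the value group of the
  inertia field being that of `K_v`) and **completeness** (`exists_limit_of_mem_adjoin`: a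
  sequence in `K_v(ζ)` with `|x_{r+1} - x_r|_v ≤ ρ^{r+1}`, `ρ < 1`, has a limit `y ∈ K_v(ζ)` with
  `|y - x_r|_v ≤ ρ^{r+1}`; Mathlib's `spectralNorm.completeSpace` for the finite-dimensional
  `K_v(ζ)` and the ultrametric inequality).

These are the hypotheses `hFK`, `hFn`, `hdisc`, `hcomplete` (and the descent behind `hlift`) of
the abstract successive approximation `FormalGroupChart.exists_map_sub_eq_of_sum_eq_zero`
(`UnramifiedFormalGroupH1Proofs`).

## References

* [SerreLocalFields1979] J.-P. Serre, *Local Fields*, GTM 67 (1979), Ch. IV §4 (structure of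
  `K_nr`: `K_nr = ∪ K(μ_m)`, `(m, p) = 1`), Ch. I §8 (Frobenius).
* [NeukirchANT1999] J. Neukirch, *Algebraic Number Theory* (1999), Ch. II (7.12)–(7.13)
  (unramified extensions and roots of unity), §9 (9.9)–(9.11).
* [MilneADT2006] J. S. Milne, *Arithmetic Duality Theorems*, 2nd ed. (2006), §I.2 (notation),
  Prop. I.3.8.

## Design

No definitions; `noncomputable section`; `open scoped Classical NNReal Pointwise`; one universe
`u` (`K : Type u`).  The spectral valuation is quantified with its defining property `hw` as in
`SelmerFiniteProofs`; the layer is always written `IntermediateField.adjoin (v.adicCompletion K) {ζ}`.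
-/

noncomputable section

open scoped Classical NNReal Pointwise
open NumberField IsDedekindDomain

universe u

/-! ## §1 Roots of unity of order prime to the residue characteristic under a valuation -/

namespace Literature.NumberTheory.EllipticCurves

section RootsOfUnity

variable {L : Type*} [Field L] (w : Valuation L ℝ≥0)

/-- A root of unity has valuation `1`. [folklore] -/
theorem val_eq_one_of_pow_eq_one {ζ : L} {m : ℕ} (hm : m ≠ 0) (h : ζ ^ m = 1) : w ζ = 1 := by
  have h1 : w ζ ^ m = 1 := by rw [← map_pow, h, map_one]
  exact (pow_eq_one_iff_of_nonneg zero_le hm).mp h1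

/-- `|1 + η + ⋯ + η^{d-1}| = 1` when `|η - 1| < 1` and `|d| = 1`: each `ηⁱ - 1 = (η - 1)(⋯)` is
small, so the sum is `d` up to something of valuation `< 1`. [folklore] -/
theorem val_geom_sum_eq_one {η : L} {d : ℕ} (hd : w (d : L) = 1) (hη1 : w η ≤ 1)
    (h1 : w (η - 1) < 1) : w (∑ i ∈ Finset.range d, η ^ i) = 1 := by
  -- `Σ ηⁱ = d + Σ (ηⁱ - 1)` and `|ηⁱ - 1| < 1`
  have hpow : ∀ i : ℕ, w (η ^ i - 1) < 1 := by
    intro i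
    rw [← mul_geom_sum η i]
    rw [map_mul]
    have hs : w (∑ j ∈ Finset.range i, η ^ j) ≤ 1 := by
      refine Valuation.map_sum_le w fun j _ ↦ ?_
      rw [map_pow]; exact pow_le_one₀ zero_le hη1
    calc w (η - 1) * w (∑ j ∈ Finset.range i, η ^ j) ≤ w (η - 1) * 1 := by gcongr
      _ = w (η - 1) := mul_one _
      _ < 1 := h1
  have hsum : w (∑ i ∈ Finset.range d, (η ^ i - 1)) < 1 := by
    refine Valuation.map_sum_lt w one_ne_zero fun i _ ↦ hpow i
  have e : ∑ i ∈ Finset.range d, η ^ i = (d : L) + ∑ i ∈ Finset.range d, (η ^ i - 1) := by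
    rw [Finset.sum_sub_distrib, Finset.sum_const, Finset.card_range, nsmul_eq_mul, mul_one]
    ring
  rw [e, Valuation.map_add_eq_of_lt_left w (by rw [hd]; exact hsum), hd]

/-- **Roots of unity congruent to `1` are `1`**: if `η^d = 1` with `|d| = 1` (`d` prime to the
residue characteristic) and `|η - 1| < 1` then `η = 1` (`0 = η^d - 1 = (η - 1)(1 + η + ⋯ + η^{d-1})`
and the second factor is a unit).  Serre, *Local Fields*, IV §4 (proof of Prop. 16: reduction is
injective on `μ_m`, `(m, p) = 1`). [folklore] -/
theorem eq_one_of_pow_eq_one_of_val_sub_lt_one {η : L} {d : ℕ} (hd0 : d ≠ 0) (hd : w (d : L) = 1)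
    (hη : η ^ d = 1) (h1 : w (η - 1) < 1) : η = 1 := by
  have hη1 : w η ≤ 1 := (val_eq_one_of_pow_eq_one w hd0 hη).le
  have hgs := val_geom_sum_eq_one w hd hη1 h1
  have hprod : (η - 1) * ∑ i ∈ Finset.range d, η ^ i = 0 := by rw [mul_geom_sum, hη, sub_self]
  rcases mul_eq_zero.mp hprod with h | h
  · exact sub_eq_zero.mp h
  · rw [h, map_zero] at hgs; exact (zero_ne_one hgs).elim

/-- Two `m`-th roots of unity (`|m| = 1`) congruent modulo the maximal ideal are equal.
[folklore] -/
theorem eq_of_pow_eq_one_of_val_sub_lt_one {ζ ζ' : L} {m : ℕ} (hm0 : m ≠ 0) (hm : w (m : L) = 1)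
    (hζ : ζ ^ m = 1) (hζ' : ζ' ^ m = 1) (h : w (ζ - ζ') < 1) : ζ = ζ' := by
  have hζ'0 : ζ' ≠ 0 := by
    rintro rfl; rw [zero_pow hm0] at hζ'; exact zero_ne_one hζ'
  have hq : (ζ * ζ'⁻¹) ^ m = 1 := by rw [mul_pow, inv_pow, hζ, hζ', inv_one, mul_one]
  have h1 : w (ζ * ζ'⁻¹ - 1) < 1 := by
    have e : ζ * ζ'⁻¹ - 1 = (ζ - ζ') * ζ'⁻¹ := by field_simp
    rw [e, map_mul, map_inv₀, val_eq_one_of_pow_eq_one w hm0 hζ', inv_one, mul_one]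
    exact h
  have := eq_one_of_pow_eq_one_of_val_sub_lt_one w hm0 hm hq h1
  calc ζ = ζ * ζ'⁻¹ * ζ' := by rw [inv_mul_cancel_right₀ hζ'0]
    _ = ζ' := by rw [this, one_mul]

end RootsOfUnity

end Literature.NumberTheory.EllipticCurves

/-! ## §2 Roots of unity of order `qⁿ - 1` in `K̄_v`: inertia and Frobenius -/

namespace IsDedekindDomain.HeightOneSpectrum

open Literature.NumberTheory.EllipticCurves Literature.NumberTheory.GaloisRepresentations Field

variable {K : Type u} [Field K] [NumberField K] (v : HeightOneSpectrum (𝓞 K))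

section Spectral

variable {v} {w : Valuation (AlgebraicClosure (v.adicCompletion K)) ℝ≥0}
  (hw : ∀ x, (w x : ℝ) = spectralNorm (v.adicCompletion K) (AlgebraicClosure (v.adicCompletion K)) x)
include hw

/-- An integer of `v` has `|x|_v < 1` in `K̄_v`: `x ∈ v`. [folklore] -/
theorem spectralValuation_algebraMap_ringOfIntegers_lt_one {x : 𝓞 K} (hx : x ∈ v.asIdeal) :
    w (algebraMap (𝓞 K) (AlgebraicClosure (v.adicCompletion K)) x) < 1 := by
  rw [← NNReal.coe_lt_coe, algebraMap_ringOfIntegers_algClosure_apply, coe_spectralValuation_algebraMap hw,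
    NNReal.coe_one, Valued.toNormedField.norm_lt_one_iff, valuedAdicCompletion_eq_valuation']
  exact (v.valuation_lt_one_iff_mem x).mpr hx

/-- **`|q_v|_v < 1`**: the residue cardinality `q_v = #k_v = N(v)` lies in `v`. [folklore] -/
theorem spectralValuation_natCast_residueCard_lt_one :
    w (Nat.card (IsLocalRing.ResidueField (v.adicCompletionIntegers K)) :
      AlgebraicClosure (v.adicCompletion K)) < 1 := by
  rw [WeierstrassCurve.natCard_residueField_eq_residueCard v]
  have hmem : ((v.residueCard : ℕ) : 𝓞 K) ∈ v.asIdeal := by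
    rw [residueCard]; exact Ideal.absNorm_mem v.asIdeal
  have := spectralValuation_algebraMap_ringOfIntegers_lt_one hw hmem
  rwa [map_natCast] at this

/-- **`|qⁿ - 1|_v = 1`** for `n ≠ 0`: `qⁿ - 1 ≡ -1 (mod v)`. [folklore] -/
theorem spectralValuation_natCast_residueCard_pow_sub_one {n : ℕ} (hn : n ≠ 0) :
    w ((Nat.card (IsLocalRing.ResidueField (v.adicCompletionIntegers K)) ^ n - 1 : ℕ) :
      AlgebraicClosure (v.adicCompletion K)) = 1 := by
  set q := Nat.card (IsLocalRing.ResidueField (v.adicCompletionIntegers K)) with hq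
  have hq1 : 1 ≤ q ^ n := Nat.one_le_pow n q Nat.card_pos
  have e : ((q ^ n - 1 : ℕ) : AlgebraicClosure (v.adicCompletion K)) = -1 + (q : _) ^ n := by
    rw [Nat.cast_sub hq1, Nat.cast_pow, Nat.cast_one]; ring
  rw [e, Valuation.map_add_eq_of_lt_left w ?_, Valuation.map_neg, map_one]
  rw [Valuation.map_neg, map_one, map_pow]
  exact pow_lt_one₀ zero_le (spectralValuation_natCast_residueCard_lt_one hw) hn

omit hw in
/-- **Primitive `(qⁿ - 1)`-th roots of unity exist in `K̄_v`** (algebraically closed of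
characteristic `0`). [folklore] -/
theorem exists_isPrimitiveRoot_residueCard_pow_sub_one {n : ℕ} (hn : n ≠ 0) :
    ∃ ζ : AlgebraicClosure (v.adicCompletion K),
      IsPrimitiveRoot ζ (Nat.card (IsLocalRing.ResidueField (v.adicCompletionIntegers K)) ^ n - 1) := by
  haveI : CharZero (v.adicCompletion K) :=
    charZero_of_injective_algebraMap (algebraMap K (v.adicCompletion K)).injective
  haveI : CharZero (AlgebraicClosure (v.adicCompletion K)) :=
    charZero_of_injective_algebraMap (algebraMap (v.adicCompletion K) _).injective
  set m := Nat.card (IsLocalRing.ResidueField (v.adicCompletionIntegers K)) ^ n - 1 with hm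
  have hq : 1 < Nat.card (IsLocalRing.ResidueField (v.adicCompletionIntegers K)) := by
    haveI : Finite (IsLocalRing.ResidueField (v.adicCompletionIntegers K)) :=
      finite_residueField_adicCompletionIntegers K v
    exact Finite.one_lt_card
  have hm0 : m ≠ 0 := (Nat.sub_pos_of_lt (Nat.one_lt_pow hn hq)).ne'
  haveI : NeZero m := ⟨hm0⟩
  haveI : NeZero (m : AlgebraicClosure (v.adicCompletion K)) := NeZero.charZero
  exact HasEnoughRootsOfUnity.exists_primitiveRoot (AlgebraicClosure (v.adicCompletion K)) m

omit hw in
/-- `qⁿ - 1 ≠ 0` for `n ≠ 0` (`q = #k_v ≥ 2`). [folklore] -/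
theorem residueCard_pow_sub_one_ne_zero {n : ℕ} (hn : n ≠ 0) :
    Nat.card (IsLocalRing.ResidueField (v.adicCompletionIntegers K)) ^ n - 1 ≠ 0 := by
  have hq : 1 < Nat.card (IsLocalRing.ResidueField (v.adicCompletionIntegers K)) := by
    haveI : Finite (IsLocalRing.ResidueField (v.adicCompletionIntegers K)) :=
      finite_residueField_adicCompletionIntegers K v
    exact Finite.one_lt_card
  exact (Nat.sub_pos_of_lt (Nat.one_lt_pow hn hq)).ne'

/-- **Inertia fixes the roots of unity of order prime to `p`**: for `τ ∈ I_𝔐` and `ζ^m = 1` with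
`|m|_v = 1`, `τ ζ = ζ` (`τ ζ ≡ ζ (mod 𝔐)` and both are `m`-th roots of unity).  Serre, *Local
Fields*, IV §4 Prop. 16 (`μ_m ⊆ K_nr`); the tree's `mem_absInertia_iff_smul_rootsOfUnity` is
the same statement for the abstract local field. [cite: SerreLocalFields1979, Ch. IV §4 Prop. 16] -/
theorem smul_eq_self_of_mem_inertia_of_pow_eq_one {𝔐 : Ideal v.localAbsIntegers}
    (h𝔐 : 𝔐 ∈ v.localPrimesAbove) {τ : absoluteGaloisGroup (v.adicCompletion K)}
    (hτ : τ ∈ 𝔐.inertia (absoluteGaloisGroup (v.adicCompletion K)))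
    {ζ : AlgebraicClosure (v.adicCompletion K)} {m : ℕ} (hm0 : m ≠ 0)
    (hm : w (m : AlgebraicClosure (v.adicCompletion K)) = 1) (hζ : ζ ^ m = 1) : τ • ζ = ζ := by
  have hζ1 : w ζ = 1 := val_eq_one_of_pow_eq_one w hm0 hζ
  have hlt : w (τ • ζ - ζ) < 1 := (mem_inertia_iff_spectralValuation hw h𝔐).mp hτ ζ hζ1.le
  have hτζ : (τ • ζ) ^ m = 1 := by rw [← smul_pow', hζ, smul_one]
  exact eq_of_pow_eq_one_of_val_sub_lt_one w hm0 hm hτζ hζ hlt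

/-- **An arithmetic Frobenius raises roots of unity of order prime to `p` to the `q`-th power**:
`F ζ = ζ^q` for `ζ^m = 1`, `|m|_v = 1` (`F ζ ≡ ζ^q (mod 𝔐)` and both are `m`-th roots of unity).
Serre, *Local Fields*, IV §4 (the Frobenius of `K_nr/K` on `μ_m`); Neukirch II (7.12).
[cite: SerreLocalFields1979, Ch. IV §4 Prop. 16] -/
theorem frobenius_smul_eq_pow_of_pow_eq_one {𝔐 : Ideal v.localAbsIntegers}
    (h𝔐 : 𝔐 ∈ v.localPrimesAbove) {F : absoluteGaloisGroup (v.adicCompletion K)}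
    (hF : IsArithFrobAt (v.adicCompletionIntegers K) F 𝔐)
    {ζ : AlgebraicClosure (v.adicCompletion K)} {m : ℕ} (hm0 : m ≠ 0)
    (hm : w (m : AlgebraicClosure (v.adicCompletion K)) = 1) (hζ : ζ ^ m = 1) :
    F • ζ = ζ ^ Nat.card (IsLocalRing.ResidueField (v.adicCompletionIntegers K)) := by
  set q := Nat.card (IsLocalRing.ResidueField (v.adicCompletionIntegers K)) with hq
  have hζ1 : w ζ = 1 := val_eq_one_of_pow_eq_one w hm0 hζ
  let b : v.localAbsIntegers := ⟨ζ, (mem_localAbsIntegers_iff_spectralValuation hw).mpr hζ1.le⟩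
  have hb : F • b - b ^ q ∈ 𝔐 := by
    have := hF b
    rwa [natCard_quotient_under_eq_of_mem_localPrimesAbove v h𝔐] at this
  have hlt : w (F • ζ - ζ ^ q) < 1 := by
    have := (mem_iff_spectralValuation_lt_one hw h𝔐).mp hb
    have e : ((F • b - b ^ q : v.localAbsIntegers) : AlgebraicClosure (v.adicCompletion K)) =
        F • ζ - ζ ^ q := by
      rw [Subalgebra.coe_sub, Subalgebra.coe_pow, integralClosure.coe_smul]
    rwa [e] at this
  have h1 : (F • ζ) ^ m = 1 := by rw [← smul_pow', hζ, smul_one]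
  have h2 : (ζ ^ q) ^ m = 1 := by rw [← pow_mul, mul_comm, pow_mul, hζ, one_pow]
  exact eq_of_pow_eq_one_of_val_sub_lt_one w hm0 hm h1 h2 hlt

/-- Powers: `Fʲ ζ = ζ^{qʲ}`. [folklore] -/
theorem frobenius_pow_smul_eq_pow_of_pow_eq_one {𝔐 : Ideal v.localAbsIntegers}
    (h𝔐 : 𝔐 ∈ v.localPrimesAbove) {F : absoluteGaloisGroup (v.adicCompletion K)}
    (hF : IsArithFrobAt (v.adicCompletionIntegers K) F 𝔐)
    {ζ : AlgebraicClosure (v.adicCompletion K)} {m : ℕ} (hm0 : m ≠ 0)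
    (hm : w (m : AlgebraicClosure (v.adicCompletion K)) = 1) (hζ : ζ ^ m = 1) (j : ℕ) :
    F ^ j • ζ = ζ ^ Nat.card (IsLocalRing.ResidueField (v.adicCompletionIntegers K)) ^ j := by
  induction j with
  | zero => rw [pow_zero, one_smul, pow_zero, pow_one]
  | succ j ih =>
    rw [pow_succ', mul_smul, ih, smul_pow', frobenius_smul_eq_pow_of_pow_eq_one hw h𝔐 hF hm0 hm hζ,
      ← pow_mul, ← pow_succ']

/-- **`Fʲ` fixes a primitive `(qⁿ - 1)`-th root of unity iff `n ∣ j`** (the Frobenius of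
`K_v(ζ)/K_v` has order exactly `n`).  Serre, *Local Fields*, IV §4; Neukirch II (7.13).
[cite: SerreLocalFields1979, Ch. IV §4 Prop. 16] -/
theorem frobenius_pow_smul_eq_self_iff {𝔐 : Ideal v.localAbsIntegers}
    (h𝔐 : 𝔐 ∈ v.localPrimesAbove) {F : absoluteGaloisGroup (v.adicCompletion K)}
    (hF : IsArithFrobAt (v.adicCompletionIntegers K) F 𝔐) {n : ℕ} (hn : n ≠ 0)
    {ζ : AlgebraicClosure (v.adicCompletion K)}
    (hζ : IsPrimitiveRoot ζ (Nat.card (IsLocalRing.ResidueField (v.adicCompletionIntegers K)) ^ n - 1))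
    (j : ℕ) : F ^ j • ζ = ζ ↔ n ∣ j := by
  set q := Nat.card (IsLocalRing.ResidueField (v.adicCompletionIntegers K)) with hq
  have hq1 : 1 < q := by
    haveI : Finite (IsLocalRing.ResidueField (v.adicCompletionIntegers K)) :=
      finite_residueField_adicCompletionIntegers K v
    exact Finite.one_lt_card
  have hm0 : q ^ n - 1 ≠ 0 := residueCard_pow_sub_one_ne_zero (v := v) hn
  have hm : w ((q ^ n - 1 : ℕ) : AlgebraicClosure (v.adicCompletion K)) = 1 :=
    spectralValuation_natCast_residueCard_pow_sub_one hw hn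
  have hζ0 : ζ ≠ 0 := hζ.ne_zero hm0
  have hpow : ∀ i, F ^ i • ζ = ζ ^ q ^ i :=
    frobenius_pow_smul_eq_pow_of_pow_eq_one hw h𝔐 hF hm0 hm hζ.pow_eq_one
  -- `ζ^{qⁿ} = ζ`
  have hn1 : ζ ^ q ^ n = ζ := by
    have h1 : 1 ≤ q ^ n := Nat.one_le_pow n q (by omega)
    conv_lhs => rw [← Nat.sub_add_cancel h1, pow_succ, hζ.pow_eq_one, one_mul]
  have hkn : ∀ k, ζ ^ q ^ (n * k) = ζ := by
    intro k
    induction k with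
    | zero => rw [mul_zero, pow_zero, pow_one]
    | succ k ih => rw [Nat.mul_succ, pow_add, pow_mul, ih, hn1]
  -- `ζ^{qˢ} = ζ` with `s < n` forces `s = 0`
  have hsmall : ∀ s, s < n → ζ ^ q ^ s = ζ → s = 0 := by
    intro s hs h
    by_contra hs0
    have h1 : 1 ≤ q ^ s := Nat.one_le_pow s q (by omega)
    have h2 : ζ ^ (q ^ s - 1) = 1 := by
      have : ζ ^ (q ^ s - 1) * ζ = 1 * ζ := by
        rw [← pow_succ, Nat.sub_add_cancel h1, h, one_mul]
      exact mul_right_cancel₀ hζ0 this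
    have hdvd := (hζ.pow_eq_one_iff_dvd _).mp h2
    have hlt : q ^ s - 1 < q ^ n - 1 := by
      have := Nat.pow_lt_pow_right hq1 hs
      omega
    have hpos : 0 < q ^ s - 1 := Nat.sub_pos_of_lt (Nat.one_lt_pow hs0 hq1)
    exact absurd (Nat.le_of_dvd hpos hdvd) (not_le.mpr hlt)
  rw [hpow]
  constructor
  · intro h
    have e : j = n * (j / n) + j % n := (Nat.div_add_mod j n).symm
    rw [e, pow_add, pow_mul, hkn] at h
    have := hsmall (j % n) (Nat.mod_lt j (Nat.pos_of_ne_zero hn)) h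
    exact Nat.dvd_of_mod_eq_zero this
  · rintro ⟨k, rfl⟩
    exact hkn k

end Spectral

/-! ## §3 The layer `K_v(ζ)` -/

section Layer

variable {v} {w : Valuation (AlgebraicClosure (v.adicCompletion K)) ℝ≥0}
  (hw : ∀ x, (w x : ℝ) = spectralNorm (v.adicCompletion K) (AlgebraicClosure (v.adicCompletion K)) x)

/-- A root of unity is integral over `K_v`, so `K_v(ζ)` is finite over `K_v`. [folklore] -/
theorem finiteDimensional_adjoin_of_pow_eq_one {ζ : AlgebraicClosure (v.adicCompletion K)} {m : ℕ}
    (hm0 : m ≠ 0) (hζ : ζ ^ m = 1) :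
    FiniteDimensional (v.adicCompletion K) (IntermediateField.adjoin (v.adicCompletion K) {ζ}) :=
  IntermediateField.adjoin.finiteDimensional
    (IsIntegral.of_pow (Nat.pos_of_ne_zero hm0) (by rw [hζ]; exact isIntegral_one))

/-- **An algebra endomorphism fixing `ζ` fixes `K_v(ζ)` pointwise.** [folklore] -/
theorem algHom_apply_eq_self_of_mem_adjoin {ζ : AlgebraicClosure (v.adicCompletion K)} {m : ℕ}
    (hm0 : m ≠ 0) (hζ : ζ ^ m = 1)
    (f : AlgebraicClosure (v.adicCompletion K) →ₐ[v.adicCompletion K] AlgebraicClosure (v.adicCompletion K))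
    (hf : f ζ = ζ) {x : AlgebraicClosure (v.adicCompletion K)}
    (hx : x ∈ IntermediateField.adjoin (v.adicCompletion K) {ζ}) : f x = x := by
  have hint : IsIntegral (v.adicCompletion K) ζ :=
    IsIntegral.of_pow (Nat.pos_of_ne_zero hm0) (by rw [hζ]; exact isIntegral_one)
  have hx' : x ∈ (IntermediateField.adjoin (v.adicCompletion K) {ζ}).toSubalgebra := hx
  rw [IntermediateField.adjoin_simple_toSubalgebra_of_isAlgebraic hint.isAlgebraic] at hx'
  have hle : Algebra.adjoin (v.adicCompletion K) {ζ} ≤ AlgHom.equalizer f (AlgHom.id _ _) :=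
    Algebra.adjoin_le (Set.singleton_subset_iff.mpr (by rw [SetLike.mem_coe, AlgHom.mem_equalizer]; exact hf))
  exact hle hx'

/-- `σ ∈ Γ_{K_v}` fixes `K_v(ζ)` pointwise iff `σ ζ = ζ`. [folklore] -/
theorem forall_smul_eq_self_iff_smul_eq {ζ : AlgebraicClosure (v.adicCompletion K)} {m : ℕ}
    (hm0 : m ≠ 0) (hζ : ζ ^ m = 1) (σ : absoluteGaloisGroup (v.adicCompletion K)) :
    (∀ x ∈ IntermediateField.adjoin (v.adicCompletion K) {ζ}, σ • x = x) ↔ σ • ζ = ζ :=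
  ⟨fun h ↦ h ζ (IntermediateField.mem_adjoin_simple_self _ ζ), fun h _ hx ↦
    algHom_apply_eq_self_of_mem_adjoin hm0 hζ
      ((absoluteGaloisGroup.toAlgEquiv (v.adicCompletion K) σ :
        AlgebraicClosure (v.adicCompletion K) ≃ₐ[v.adicCompletion K]
          AlgebraicClosure (v.adicCompletion K)) :
        AlgebraicClosure (v.adicCompletion K) →ₐ[v.adicCompletion K]
          AlgebraicClosure (v.adicCompletion K)) h hx⟩

/-- **`K_v(ζ)` is stable under any `σ ∈ Γ_{K_v}`** with `σ ζ = ζ^e`. [folklore] -/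
theorem smul_mem_adjoin_of_smul_eq_pow {ζ : AlgebraicClosure (v.adicCompletion K)}
    {σ : absoluteGaloisGroup (v.adicCompletion K)} {e : ℕ} (hσ : σ • ζ = ζ ^ e)
    {x : AlgebraicClosure (v.adicCompletion K)}
    (hx : x ∈ IntermediateField.adjoin (v.adicCompletion K) {ζ}) :
    σ • x ∈ IntermediateField.adjoin (v.adicCompletion K) {ζ} := by
  set f : AlgebraicClosure (v.adicCompletion K) →ₐ[v.adicCompletion K]
      AlgebraicClosure (v.adicCompletion K) :=
    ((absoluteGaloisGroup.toAlgEquiv (v.adicCompletion K) σ :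
        AlgebraicClosure (v.adicCompletion K) ≃ₐ[v.adicCompletion K]
          AlgebraicClosure (v.adicCompletion K)) :
        AlgebraicClosure (v.adicCompletion K) →ₐ[v.adicCompletion K]
          AlgebraicClosure (v.adicCompletion K)) with hf
  have hfx : f x = σ • x := rfl
  have hmem : f x ∈ (IntermediateField.adjoin (v.adicCompletion K) {ζ}).map f :=
    ⟨x, hx, rfl⟩
  rw [IntermediateField.adjoin_map, Set.image_singleton] at hmem
  have hfζ : f ζ = ζ ^ e := hσ
  rw [hfζ] at hmem
  have hle : IntermediateField.adjoin (v.adicCompletion K) {ζ ^ e} ≤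
      IntermediateField.adjoin (v.adicCompletion K) {ζ} := by
    rw [IntermediateField.adjoin_simple_le_iff]
    exact pow_mem (IntermediateField.mem_adjoin_simple_self _ ζ) e
  rw [← hfx]
  exact hle hmem

/-- **Galois descent to `K_v(ζ)`**: an element of `K̄_v` fixed by every `σ ∈ Γ_{K_v}` with
`σ ζ = ζ` lies in `K_v(ζ)` (infinite Galois theory for `K̄_v/K_v`, Mathlib
`InfiniteGalois.fixedField_fixingSubgroup`). [folklore] -/
theorem mem_adjoin_of_forall_smul_eq {ζ : AlgebraicClosure (v.adicCompletion K)}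
    {y : AlgebraicClosure (v.adicCompletion K)}
    (hy : ∀ σ : absoluteGaloisGroup (v.adicCompletion K), σ • ζ = ζ → σ • y = y) :
    y ∈ IntermediateField.adjoin (v.adicCompletion K) {ζ} := by
  haveI := isGalois_algebraicClosure_adicCompletion (v := v)
  rw [← InfiniteGalois.fixedField_fixingSubgroup (IntermediateField.adjoin (v.adicCompletion K) {ζ}),
    IntermediateField.mem_fixedField_iff]
  intro σ hσ
  rw [IntermediateField.mem_fixingSubgroup_iff] at hσ
  have h1 : (absoluteGaloisGroup.toAlgEquiv (v.adicCompletion K)).symm σ • ζ = ζ :=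
    hσ ζ (IntermediateField.mem_adjoin_simple_self _ ζ)
  exact hy _ h1

include hw

/-- **Discreteness of `K_v(ζ)`** (`ζ` of order prime to `p`, so `K_v(ζ)` lies in the inertia
field): `|x|_v < 1 ⇒ |x|_v ≤ |ϖ|_v` for `x ∈ K_v(ζ)` and a uniformiser `ϖ` of `𝓞_v` — the value
group of an unramified extension is that of `K_v` (Neukirch II (7.5); the tree's
`spectralValuation_le_of_forall_inertia`). [folklore] -/
theorem spectralValuation_le_uniformizer_of_mem_adjoin {𝔐 : Ideal v.localAbsIntegers}
    (h𝔐 : 𝔐 ∈ v.localPrimesAbove) {ζ : AlgebraicClosure (v.adicCompletion K)} {m : ℕ}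
    (hm0 : m ≠ 0) (hm : w (m : AlgebraicClosure (v.adicCompletion K)) = 1) (hζ : ζ ^ m = 1)
    {ϖ : v.adicCompletionIntegers K} (hϖ : Irreducible ϖ)
    {x : AlgebraicClosure (v.adicCompletion K)}
    (hx : x ∈ IntermediateField.adjoin (v.adicCompletion K) {ζ}) (hx1 : w x < 1) :
    w x ≤ w (algebraMap (v.adicCompletion K) (AlgebraicClosure (v.adicCompletion K))
      (ϖ : v.adicCompletion K)) := by
  refine spectralValuation_le_of_forall_inertia hw h𝔐 hϖ (fun σ hσ ↦ ?_) hx1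
  have h1 : σ • ζ = ζ := smul_eq_self_of_mem_inertia_of_pow_eq_one hw h𝔐 hσ hm0 hm hζ
  exact (forall_smul_eq_self_iff_smul_eq hm0 hζ σ).mpr h1 x hx

/-- **Completeness of `K_v(ζ)`** for the spectral valuation: a sequence `(x_r)` in `K_v(ζ)` with
`|x_{r+1} - x_r|_v ≤ ρ^{r+1}`, `ρ < 1`, converges to some `y ∈ K_v(ζ)` with `|y - x_r|_v ≤ ρ^{r+1}`
(`K_v(ζ)` is finite-dimensional over the complete field `K_v`, hence complete for the spectral
norm, Mathlib `spectralNorm.completeSpace`; the bound by the ultrametric inequality). [folklore] -/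
theorem exists_limit_of_mem_adjoin {ζ : AlgebraicClosure (v.adicCompletion K)} {m : ℕ}
    (hm0 : m ≠ 0) (hζ : ζ ^ m = 1) {ρ : ℝ≥0} (hρ1 : ρ < 1)
    (x : ℕ → IntermediateField.adjoin (v.adicCompletion K) {ζ})
    (hx : ∀ r, w ((x (r + 1) : AlgebraicClosure (v.adicCompletion K)) - x r) ≤ ρ ^ (r + 1)) :
    ∃ y : IntermediateField.adjoin (v.adicCompletion K) {ζ},
      ∀ r, w ((y : AlgebraicClosure (v.adicCompletion K)) - x r) ≤ ρ ^ (r + 1) := by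
  haveI : FiniteDimensional (v.adicCompletion K)
      (IntermediateField.adjoin (v.adicCompletion K) {ζ}) :=
    finiteDimensional_adjoin_of_pow_eq_one hm0 hζ
  letI : NontriviallyNormedField (v.adicCompletion K) :=
    Valued.toNontriviallyNormedField (v.adicCompletion K) (WithZero (Multiplicative ℤ))
  letI : NormedField (IntermediateField.adjoin (v.adicCompletion K) {ζ}) :=
    spectralNorm.normedField (v.adicCompletion K) (IntermediateField.adjoin (v.adicCompletion K) {ζ})
  haveI : CompleteSpace (IntermediateField.adjoin (v.adicCompletion K) {ζ}) :=
    spectralNorm.completeSpace (v.adicCompletion K) (IntermediateField.adjoin (v.adicCompletion K) {ζ})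
  -- the norm on `K_v(ζ)` is the spectral valuation
  have hnorm : ∀ z : IntermediateField.adjoin (v.adicCompletion K) {ζ},
      ‖z‖ = (w (z : AlgebraicClosure (v.adicCompletion K)) : ℝ) := fun z ↦ by
    change spectralNorm (v.adicCompletion K) (IntermediateField.adjoin (v.adicCompletion K) {ζ}) z = _
    rw [hw, spectralNorm.eq_of_tower (L := AlgebraicClosure (v.adicCompletion K))]
    rfl
  -- the ultrametric estimate `|x_{r+k} - x_r| ≤ ρ^{r+1}`
  have hultra : ∀ r k, w ((x (r + k) : AlgebraicClosure (v.adicCompletion K)) - x r) ≤ ρ ^ (r + 1) := by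
    intro r k
    induction k with
    | zero => rw [add_zero, sub_self, map_zero]; exact zero_le
    | succ k ih =>
      have e : (x (r + (k + 1)) : AlgebraicClosure (v.adicCompletion K)) - x r =
          ((x (r + k + 1) : AlgebraicClosure (v.adicCompletion K)) - x (r + k)) +
            ((x (r + k) : AlgebraicClosure (v.adicCompletion K)) - x r) := by
        rw [← add_assoc]; ring
      rw [e]
      refine (Valuation.map_add w _ _).trans (max_le ((hx (r + k)).trans ?_) ih)
      exact pow_le_pow_right_of_le_one' hρ1.le (by omega)
  -- Cauchy, hence convergent
  have hcauchy : CauchySeq x := by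
    refine cauchySeq_of_le_geometric (ρ : ℝ) (ρ : ℝ) (by exact_mod_cast hρ1) fun r ↦ ?_
    rw [dist_eq_norm, ← norm_neg, neg_sub, hnorm]
    push_cast
    rw [← pow_succ']
    exact_mod_cast hx r
  obtain ⟨y, hy⟩ := cauchySeq_tendsto_of_complete hcauchy
  refine ⟨y, fun r ↦ ?_⟩
  -- pass to the limit in `|x_{r+k} - x_r| ≤ ρ^{r+1}`
  have hshift : Filter.Tendsto (fun k ↦ x (k + r)) Filter.atTop (nhds y) :=
    hy.comp (Filter.tendsto_add_atTop_nat r)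
  have hlim : Filter.Tendsto (fun k ↦ ‖x (k + r) - x r‖) Filter.atTop (nhds ‖y - x r‖) :=
    (hshift.sub_const (x r)).norm
  have hle : ‖y - x r‖ ≤ (ρ : ℝ) ^ (r + 1) := by
    refine le_of_tendsto hlim (Filter.Eventually.of_forall fun k ↦ ?_)
    rw [hnorm, add_comm k r]
    push_cast
    exact_mod_cast hultra r k
  rw [hnorm] at hle
  push_cast at hle
  exact_mod_cast hle

end Layer

end IsDedekindDomain.HeightOneSpectrum

end
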